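import Summits.AtomisticToContinuum.Crystallization.Theorems.TwoCentreKissingKernelRobustTangencyBoundPentagonCert
import Summits.AtomisticToContinuum.Crystallization.Theorems.TwoCentreKissingKernelRobustTangencyBoundRhombusSystem
import HarnessLib

/-!
# `RobustTangencyBound` — generic cluster systems in diagonal form: the candidate point with any
# number of regular-corner blocks, and the generic evaluation of the equations (step (III) machinery)

Route `TwoCentreKissingKernel`, item `stmt-AtomisticToContinuum-12082`, blueprint (III) §5–7.  `…RhombusSystem.lean` (2 blocks) and
`…PentagonSystem.lean` (3 blocks) wrote the candidate solution and the evaluation of the system by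
hand; the hexagon lemmas and the touching configurations need 3–6 blocks, so this file does it once
for a LIST of blocks:

* `pairBlock`, `pairBlocks`, `blockOff` — the flattened `(C, S)` pairs of a list of blocks
  `B : List (List α × (α → ℝ) × (α → ℝ))` and the offset `2 Σ_{i<k} |L_i|` of block `k`;
  `getD_pairBlocks_even/odd`, `forall₂_pairBlocks`;
* `clusterPt base B` — the candidate point `base ++ pairBlocks B`; `clusterPt_lt` (base
  coordinates), `clusterPt_block`, `clusterPt_mem` (box membership), `map_zOf_regVars_block`;
* `clusterHs facs ms off` — the equations in the order produced by `work/cluster_proto.py`: for each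
  constrained vertex, the unit circles of its `m` regular corners, then its vertex condition
  `cprodR (fac ++ regVars off m) = 1` (real part `− 1`, imaginary part);
* `clusterHs_eval` — if the regular blocks of the point are lists `W_k` of unit complex numbers and
  each vertex product `Π fac_k · Π W_k = 1`, every equation evaluates to `0`.
-/

noncomputable section

namespace Summit.AtomisticToContinuum.Crystallization.Theorems

open Real Literature.Analysis.ValidatedNumerics Finset

/-! ### Blocks of `(C, S)` pairs -/

section Blocks

variable {α : Type*}

/-- The flattened `(C c, S c)` pairs of one block. -/
def pairBlock (b : List α × (α → ℝ) × (α → ℝ)) : List ℝ := (b.1.map fun c => [b.2.1 c, b.2.2 c]).flatten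

/-- The flattened pairs of a list of blocks. -/
def pairBlocks (B : List (List α × (α → ℝ) × (α → ℝ))) : List ℝ := (B.map pairBlock).flatten

/-- The offset of block `k`: twice the total length of the blocks before it. -/
def blockOff (B : List (List α × (α → ℝ) × (α → ℝ))) (k : ℕ) : ℕ :=
  2 * ((B.take k).map fun b => b.1.length).sum

/-- Length of one block. -/
theorem length_pairBlock (b : List α × (α → ℝ) × (α → ℝ)) : (pairBlock b).length = 2 * b.1.length :=
  length_pairs b.1

/-- Offset of block `0`. -/
theorem blockOff_zero (B : List (List α × (α → ℝ) × (α → ℝ))) : blockOff B 0 = 0 := by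
  simp [blockOff]

/-- Offset of block `k + 1` of `b :: B`. -/
theorem blockOff_cons_succ (b : List α × (α → ℝ) × (α → ℝ)) (B : List (List α × (α → ℝ) × (α → ℝ)))
    (k : ℕ) : blockOff (b :: B) (k + 1) = 2 * b.1.length + blockOff B k := by
  simp [blockOff, List.take_succ_cons, mul_add]

/-- **Coordinates inside the blocks** (even positions: `C`). -/
theorem getD_pairBlocks_even (d : α) :
    ∀ (B : List (List α × (α → ℝ) × (α → ℝ))) (k : ℕ) (hk : k < B.length) (j : ℕ),
      j < (B[k]).1.length →
      (pairBlocks B).getD (blockOff B k + 2 * j) 0 = (B[k]).2.1 ((B[k]).1.getD j d)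
  | [], k, hk, j, _ => by simp at hk
  | b :: B, 0, _, j, hj => by
    rw [blockOff_zero, zero_add, pairBlocks, List.map_cons, List.flatten_cons,
      List.getD_append _ _ _ _ (by rw [length_pairBlock]; simp at hj ⊢; omega)]
    exact getD_pairs_even d b.1 j (by simpa using hj)
  | b :: B, k + 1, hk, j, hj => by
    rw [blockOff_cons_succ, pairBlocks, List.map_cons, List.flatten_cons, add_assoc,
      List.getD_append_right _ _ _ _ (by rw [length_pairBlock]; omega), length_pairBlock,
      show 2 * b.1.length + (blockOff B k + 2 * j) - 2 * b.1.length = blockOff B k + 2 * j by omega]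
    exact getD_pairBlocks_even d B k (by simpa using hk) j (by simpa using hj)

/-- **Coordinates inside the blocks** (odd positions: `S`). -/
theorem getD_pairBlocks_odd (d : α) :
    ∀ (B : List (List α × (α → ℝ) × (α → ℝ))) (k : ℕ) (hk : k < B.length) (j : ℕ),
      j < (B[k]).1.length →
      (pairBlocks B).getD (blockOff B k + 2 * j + 1) 0 = (B[k]).2.2 ((B[k]).1.getD j d)
  | [], k, hk, j, _ => by simp at hk
  | b :: B, 0, _, j, hj => by
    rw [blockOff_zero, zero_add, pairBlocks, List.map_cons, List.flatten_cons,
      List.getD_append _ _ _ _ (by rw [length_pairBlock]; simp at hj ⊢; omega)]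
    exact getD_pairs_odd d b.1 j (by simpa using hj)
  | b :: B, k + 1, hk, j, hj => by
    rw [blockOff_cons_succ, pairBlocks, List.map_cons, List.flatten_cons,
      show 2 * b.1.length + blockOff B k + 2 * j + 1 = 2 * b.1.length + (blockOff B k + 2 * j + 1) by ring,
      List.getD_append_right _ _ _ _ (by rw [length_pairBlock]; omega), length_pairBlock,
      show 2 * b.1.length + (blockOff B k + 2 * j + 1) - 2 * b.1.length = blockOff B k + 2 * j + 1
        by omega]
    exact getD_pairBlocks_odd d B k (by simpa using hk) j (by simpa using hj)

/-- **The blocks lie in the window box** when every `(C c, S c)` does. -/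
theorem forall₂_pairBlocks {I J : ℚ × ℚ} :
    ∀ B : List (List α × (α → ℝ) × (α → ℝ)),
      (∀ b ∈ B, ∀ c ∈ b.1, InIvl I (b.2.1 c) ∧ InIvl J (b.2.2 c)) →
      List.Forall₂ InIvl (List.replicate ((B.map fun b => b.1.length).sum) [I, J]).flatten (pairBlocks B)
  | [], _ => by simp [pairBlocks]
  | b :: B, h => by
    rw [List.map_cons, List.sum_cons, List.replicate_add, List.flatten_append, pairBlocks,
      List.map_cons, List.flatten_cons]
    exact forall₂_append (forall₂_pairs b.1 (h b List.mem_cons_self))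
      (forall₂_pairBlocks B fun b' hb' => h b' (List.mem_cons_of_mem _ hb'))

end Blocks

/-! ### The candidate point -/

section Point

variable {α : Type*} (base : List ℝ) (B : List (List α × (α → ℝ) × (α → ℝ))) (d : α)

/-- **The candidate solution of a cluster system**: the base coordinates, then the blocks. -/
def clusterPt : ℕ → ℝ := fun i => (base ++ pairBlocks B).getD i 0

/-- Base coordinates. -/
theorem clusterPt_lt {i : ℕ} (hi : i < base.length) : clusterPt base B i = base.getD i 0 := by
  simp only [clusterPt]; rw [List.getD_append _ _ _ _ hi]

/-- Block coordinates. -/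
theorem clusterPt_block {k : ℕ} (hk : k < B.length) {j : ℕ} (hj : j < (B[k]).1.length) :
    clusterPt base B (base.length + blockOff B k + 2 * j) = (B[k]).2.1 ((B[k]).1.getD j d) ∧
    clusterPt base B (base.length + blockOff B k + 2 * j + 1) = (B[k]).2.2 ((B[k]).1.getD j d) := by
  constructor
  · simp only [clusterPt]
    rw [add_assoc, List.getD_append_right _ _ _ _ (by omega),
      show base.length + (blockOff B k + 2 * j) - base.length = blockOff B k + 2 * j by omega]
    exact getD_pairBlocks_even d B k hk j hj
  · simp only [clusterPt]
    rw [add_assoc, add_assoc, List.getD_append_right _ _ _ _ (by omega),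
      show base.length + (blockOff B k + (2 * j + 1)) - base.length = blockOff B k + 2 * j + 1 by omega]
    exact getD_pairBlocks_odd d B k hk j hj

/-- **The candidate point lies in the box** `baseBox ++ (replicate (Σ |L_k|) [I, J]).flatten`. -/
theorem clusterPt_mem {baseBox : Box} {I J : ℚ × ℚ} (hbase : List.Forall₂ InIvl baseBox base)
    (hB : ∀ b ∈ B, ∀ c ∈ b.1, InIvl I (b.2.1 c) ∧ InIvl J (b.2.2 c)) :
    Box.mem (baseBox ++ (List.replicate ((B.map fun b => b.1.length).sum) [I, J]).flatten)
      (clusterPt base B) :=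
  boxmem_of_forall₂ (forall₂_append hbase (forall₂_pairBlocks B hB))

/-- **A regular block of the system evaluates to the given complex numbers.** -/
theorem map_zOf_regVars_block {k : ℕ} (hk : k < B.length) :
    (regVars (base.length + blockOff B k) (B[k]).1.length).map (zOf (clusterPt base B)) =
      (B[k]).1.map fun c => (((B[k]).2.1 c : ℝ) : ℂ) + (((B[k]).2.2 c : ℝ) : ℂ) * Complex.I := by
  apply List.ext_getElem
  · simp [regVars]
  · intro j h1 h2
    have hj : j < (B[k]).1.length := by simpa [regVars] using h1
    obtain ⟨e1, e2⟩ := clusterPt_block base B ((B[k]).1[j]) hk hj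
    simp only [regVars, List.getElem_map, List.getElem_range, zOf, RExpr.eval]
    rw [e1, e2, List.getD_eq_getElem _ _ hj]

end Point

/-! ### The equations and their evaluation -/

/-- **The equations of a cluster system**, vertex by vertex: the unit circles of the `m` regular
corners of the vertex (variables from `off`), then its vertex condition in product form. -/
def clusterHs : List (List (RExpr × RExpr)) → List ℕ → ℕ → List RExpr
  | f :: fs, m :: ms, off =>
    ((regVars off m).map circR ++
      [.sub (cprodR (f ++ regVars off m)).1 (.const 1), (cprodR (f ++ regVars off m)).2]) ++
      clusterHs fs ms (off + 2 * m)
  | _, _, _ => []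

/-- A pair of variables evaluates, under `zOf`, to its two coordinates. -/
theorem zOf_var_pair (p : ℕ → ℝ) (a b : ℕ) :
    zOf p (.var a, .var b) = ((p a : ℝ) : ℂ) + ((p b : ℝ) : ℂ) * Complex.I := rfl

/-- **Evaluation of the equations.** If, for every constrained vertex `k`, the regular block of the
point read from offset `off + 2 Σ_{i<k} m_i` is the list `W_k` of unit complex numbers and
`Π fac_k · Π W_k = 1`, then every equation of `clusterHs` evaluates to `0` at the point. -/
theorem clusterHs_eval (p : ℕ → ℝ) :
    ∀ (facs : List (List (RExpr × RExpr))) (Ws : List (List ℂ)) (off : ℕ),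
      facs.length = Ws.length →
      (∀ (k : ℕ) (hk : k < Ws.length),
        (regVars (off + 2 * ((Ws.take k).map List.length).sum) (Ws[k]).length).map (zOf p) = Ws[k]) →
      (∀ (k : ℕ) (hk : k < Ws.length), ∀ w ∈ Ws[k], w.re ^ 2 + w.im ^ 2 = 1) →
      (∀ (k : ℕ) (hk : k < Ws.length) (hk' : k < facs.length),
        ((facs[k]).map (zOf p)).prod * (Ws[k]).prod = 1) →
      ∀ e ∈ clusterHs facs (Ws.map List.length) off, e.eval p = 0
  | [], [], off, _, _, _, _ => by simp [clusterHs]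
  | [], W :: Ws, off, h, _, _, _ => by simp at h
  | f :: fs, [], off, h, _, _, _ => by simp at h
  | f :: fs, W :: Ws, off, hlen, hreg, hunit, hprod => by
    intro e he
    have hreg0 := hreg 0 (by simp)
    simp only [List.take_zero, List.map_nil, List.sum_nil, mul_zero, add_zero,
      List.getElem_cons_zero] at hreg0
    rw [List.map_cons, clusterHs, List.mem_append, List.mem_append] at he
    rcases he with (hA | hE) | hrest
    · -- a unit circle of a regular corner of this vertex
      simp only [regVars, List.map_map, List.mem_map, List.mem_range, Function.comp_apply] at hA
      obtain ⟨j, hj, rfl⟩ := hA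
      have hjW : j < W.length := hj
      have hz : zOf p (.var (off + 2 * j), .var (off + 2 * j + 1)) = W[j] := by
        have := congrArg (fun l => l[j]?) hreg0
        simp only [List.getElem?_map] at this
        simp only [regVars, List.getElem?_map, List.getElem?_range hj, Option.map_some] at this
        simpa [List.getElem?_eq_getElem hjW] using this
      rw [zOf_var_pair] at hz
      have hre := congrArg Complex.re hz
      have him := congrArg Complex.im hz
      simp at hre him
      have hu := hunit 0 (by simp) (W[j]) (by simp [List.getElem_mem])
      simp only [circR, RExpr.eval]
      rw [hre, him]
      push_cast
      linarith [hu]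
    · -- the vertex condition of this vertex
      have hz : zOf p (cprodR (f ++ regVars off W.length)) = 1 := by
        rw [zOf_cprodR, List.map_append, List.prod_append, hreg0]
        exact hprod 0 (by simp) (by simp)
      have h1 := congrArg Complex.re hz
      have h2 := congrArg Complex.im hz
      simp only [zOf, Complex.add_re, Complex.ofReal_re, Complex.mul_re, Complex.I_re, mul_zero,
        Complex.ofReal_im, Complex.I_im, mul_one, sub_self, add_zero, Complex.one_re, Complex.add_im,
        Complex.mul_im, zero_add, Complex.one_im] at h1 h2
      simp only [List.mem_cons, List.mem_nil_iff, or_false] at hE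
      rcases hE with rfl | rfl
      · simp only [RExpr.eval]; rw [h1]; push_cast; ring
      · exact h2
    · -- the remaining vertices
      refine clusterHs_eval p fs Ws (off + 2 * W.length) (by simpa using hlen) ?_ ?_ ?_ e hrest
      · intro k hk
        have := hreg (k + 1) (by simpa using hk)
        simp only [List.take_succ_cons, List.map_cons, List.sum_cons, List.getElem_cons_succ] at this
        rw [show off + 2 * (W.length + ((Ws.take k).map List.length).sum) =
          off + 2 * W.length + 2 * ((Ws.take k).map List.length).sum by ring] at this
        exact this
      · intro k hk w hw
        exact hunit (k + 1) (by simpa using hk) w (by simpa using hw)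
      · intro k hk hk'
        exact hprod (k + 1) (by simpa using hk) (by simpa using hk')

end Summit.AtomisticToContinuum.Crystallization.Theorems

end
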